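import Summits.Ventures.PercRepro.RankLevelSetPerElemFiveGirth

/-! # RankLevelSetPerElemGirthClass — (★★) AND MONO ON EVERY MATROID OF GIRTH `≥ 4` WITH `≤ 13` ELEMENTS OR RANK `≤ 7`
(night-1 g36; dossier §48.21; on `RankLevelSetPerElemFiveGirth`)

With `perElemAt_five_of_girth` the level `5` is available on every matroid of girth `≥ 4`, so the class theorems of
`RankLevelSetPerElemFour` extend by one: **`biIndepPerElem_of_ncard_le_thirteen_of_girth`** /
**`biIndepMono_of_ncard_le_thirteen_of_girth`** (`#E ≤ 13`: only the levels `≤ 5` occur) and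
**`biIndepPerElem_of_eRank_le_seven_of_girth`** / **`biIndepMono_of_eRank_le_seven_of_girth`** (`rk M ≤ 7`: a
bi-independent `j`-set at a level `j ≥ 6` below the middle would have an independent complement of `≥ 8`
elements). Every declaration has a docstring; imports: the cell's own modules and Mathlib only. Axioms:
standard. -/

namespace PercRepro

open Set Matroid

variable {α : Type} (M : Matroid α) [M.Finite]

/-- **(★★) at every level `j ≤ 5` on a matroid of girth `≥ 4`** (`2j + 1 < #E`). -/
theorem perElemAt_le_five_of_girth (hg : ∀ C, M.IsCircuit C → 4 ≤ C.ncard) {y : α} (hy : y ∈ M.E) {j : ℕ}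
    (hj : j ≤ 5) (hn : 2 * j + 1 < M.E.ncard) :
    {Z ∈ biIndep M j | y ∉ Z}.ncard ≤ {Q ∈ biIndep M (j + 1) | y ∈ Q}.ncard := by
  rcases Nat.lt_or_ge j 5 with h4 | h5
  · exact perElemAt_le_four M hy (by omega) hn
  · have : j = 5 := by omega
    subst this
    exact perElemAt_five_of_girth M hg hy (by omega)

/-- **(★★) holds on every matroid of girth `≥ 4` with at most `13` elements** (only the levels `≤ 5` occur). -/
theorem biIndepPerElem_of_ncard_le_thirteen_of_girth (hg : ∀ C, M.IsCircuit C → 4 ≤ C.ncard)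
    (hn : M.E.ncard ≤ 13) : BiIndepPerElem M :=
  fun _ hy j hj => perElemAt_le_five_of_girth M hg hy (by omega) hj

/-- **Mono holds on every matroid of girth `≥ 4` with at most `13` elements**. -/
theorem biIndepMono_of_ncard_le_thirteen_of_girth (hg : ∀ C, M.IsCircuit C → 4 ≤ C.ncard)
    (hn : M.E.ncard ≤ 13) : BiIndepMono M :=
  biIndepMono_of_perElem M (biIndepPerElem_of_ncard_le_thirteen_of_girth M hg hn)

/-- **(★★) holds on every matroid of girth `≥ 4` and rank at most `7`**: at a level `j ≥ 6` with `2j + 1 < #E` a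
bi-independent `j`-set would have an independent complement of `#E − j ≥ 8` elements. -/
theorem biIndepPerElem_of_eRank_le_seven_of_girth (hg : ∀ C, M.IsCircuit C → 4 ≤ C.ncard)
    (hr : M.eRank ≤ 7) : BiIndepPerElem M := by
  intro y hy j hj
  rcases Nat.lt_or_ge j 6 with h5 | h6
  · exact perElemAt_le_five_of_girth M hg hy (by omega) hj
  · have hempty : biIndep M j = ∅ := by
      refine biIndep_eq_empty_of_eRank_lt M (lt_of_le_of_lt hr ?_)
      have h8 : (8 : ℕ) ≤ M.E.ncard - j := by omega
      calc (7 : ℕ∞) < ((8 : ℕ) : ℕ∞) := by norm_num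
        _ ≤ ((M.E.ncard - j : ℕ) : ℕ∞) := by exact_mod_cast h8
    have hL : {Z ∈ biIndep M j | y ∉ Z} = ∅ := by
      rw [hempty]
      ext Z
      simp
    rw [hL, Set.ncard_empty]
    exact Nat.zero_le _

/-- **Mono holds on every matroid of girth `≥ 4` and rank at most `7`**. -/
theorem biIndepMono_of_eRank_le_seven_of_girth (hg : ∀ C, M.IsCircuit C → 4 ≤ C.ncard) (hr : M.eRank ≤ 7) :
    BiIndepMono M :=
  biIndepMono_of_perElem M (biIndepPerElem_of_eRank_le_seven_of_girth M hg hr)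

end PercRepro
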